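import Mathlib
import Literature.Analysis.FluidPDE.Tao2016AveragedNS.ShiftSetCascadeFlows
import Literature.Analysis.FluidPDE.Tao2016AveragedNS.ShiftSetCascadeFlux
import Summits.NavierStokesRegularity.NavierStokesRegularity.Theorems.TaoLadderRungTwoFlatCertificateGlueCheckerLandGenOn
import HarnessLib

/-!
# Certificate glue on a shift set `𝕊`, XXXIV-c: READOUT-L, THE TEST — the landing readout with a LINEAR amplitude functional and a reference state
  CLIPPED onto a fat core box, evaluated on the section-node PARALLELEPIPED (helper for items stmt-NavierStokesRegularity-22987 `FlatGapCertificatesV2`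
  (crux K_A♭ of route TaoLadderRungTwoFlat) and stmt-24295 K_A₂(64); cell harvest/h2-tao-ladder, p1 g17; theory-1 g29 ask A-77 / finding F-40, spec
  `A77-READOUT-L-SPEC.md` v1.1 and `ReadoutLSpec.lean` v1.1; referee c73 ruling P158)

WHY (F-40): the landed point-reference readout `checkReadout` (glue XXXIV) reads with ONE constant amplitude and ONE reference POINT, so the whole
section-node box must fit inside the `ρ r / w_k`-ball of the point; every coordinate a hop does not contract fails by `≥ 1/ρ` — no instance exists on the
data of record. The readout clause `hread` of glue IX / XXXI is existential PER STATE, so a STATE-DEPENDENT amplitude `a' = A(x)/Cs` (a linear functional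
`A(x) = Σ_d Λ_d x_d` of the weighted coordinates) and a STATE-DEPENDENT reference state `z' = Cs·clip(read state; core box)` are admissible with no
change above the readout lemma. This file: the section-node frame / remainder as rational tables (`csArr`, `esArr`, casting to glue XXX `secFrame` /
`secErr`), the pieces `lamArr` / `ahatQ` / `acArr` / `dAQ` / `rsRowQ` / `nMatchQ`, the Boolean `checkReadoutL` (theory-1's clauses (F)(S)(M)(T)(X)(G)
verbatim, same argument list as `ReadoutLSpec.lean` v1.1), the fat core box `InCoreBox`, clipping lemmas and two linear-algebra identities. Soundness
(`read_of_checkReadoutL`) is glue XXXIV-d; the composition with the section step is glue XXXIV-e.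

HONEST FRAMING: Tao-type MODEL lattices (Tao 2016 §4/§6 vocabulary, shift-set parametrised); checker soundness — NO certificate instance exists in the
tree, nothing is certified here, no stub is closed, nothing here is a statement about the Navier–Stokes equations.
-/

-- the sub-problem namespace repeats the summit name by design (D-0017)
set_option linter.dupNamespace false

namespace Summit.NavierStokesRegularity.NavierStokesRegularity.Theorems

open Set Finset Literature.Analysis.FluidPDE Literature.Analysis.FluidPDE.TaoCascade
open Summit.NavierStokesRegularity.NavierStokesRegularity.Theorems.TaylorModelCert

namespace CertificateGlueOn

variable {m : ℕ} {Kb Ka : ℤ}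

/-! ### Rational tables of the section-node parallelepiped -/

/-- Entry access for a rational matrix stored as rows (default `0`). [folklore] -/
def qmgetD (A : Array (Array ℚ)) (r c : ℕ) : ℚ := (A.getD r #[]).getD c 0

/-- Reading an `Array.ofFn` table at a `Fin` index, any default. [folklore] -/
theorem getD_ofFn' {α : Type*} {n : ℕ} (f : Fin n → α) (dflt : α) (c : Fin n) : (Array.ofFn f).getD c dflt = f c := by
  simp [Array.getD, Array.size_ofFn, Array.getElem_ofFn]

/-- The section-node frame `C*_{c,col} = C_{c,col} − f_c (ĝ·C_col)/d̂` as a rational matrix (the entries glue XXXIV `rsQ` sums). [folklore] -/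
def csArr (n : ℕ) (qz : Array ℤ) (sr : SecRec) (C : Array (Array Dyad)) : Array (Array ℚ) :=
  let g : Array ℚ := Array.ofFn fun col : Fin n => gcolQ n qz sr.p C col
  let d := dQ n qz sr.p sr.f
  Array.ofFn fun c : Fin n => Array.ofFn fun col : Fin n =>
    dyadToRat (dmgetD C c col) - dyadToRat (dgetD sr.f c) * g.getD col 0 / d

/-- The section-node remainder row `E*_c = secErrQ … c` as a table. [folklore] -/
def esArr (n : ℕ) (qz : Array ℤ) (sr : SecRec) (E : Array Dyad) (Δ : ℚ) : Array ℚ :=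
  Array.ofFn fun c : Fin n => secErrQ n qz sr.p sr.κ E sr.Φ sr.W Δ c

/-- The entries of `csArr`. [folklore] -/
theorem qmgetD_csArr (n : ℕ) (qz : Array ℤ) (sr : SecRec) (C : Array (Array Dyad)) (c col : Fin n) :
    qmgetD (csArr n qz sr C) c col =
      dyadToRat (dmgetD C c col) - dyadToRat (dgetD sr.f c) * gcolQ n qz sr.p C col / dQ n qz sr.p sr.f := by
  unfold qmgetD csArr
  rw [getD_ofFn', getD_ofFn', getD_ofFn]

/-- `csArr` casts to the section-node frame `secFrame` of glue XXX. [folklore] -/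
theorem cast_csArr (n : ℕ) (qz : Array ℤ) (sr : SecRec) (C : Array (Array Dyad)) (c col : Fin n) :
    ((qmgetD (csArr n qz sr C) c col : ℚ) : ℝ) =
      secFrame (qvec (n := n) qz) (dvec (n := n) sr.p) (dvec (n := n) sr.f) (dmat (n := n) C) c col := by
  rw [qmgetD_csArr]
  simp only [gcolQ, gdotQ, secFrame, secGrad, qvec, dvec, dmat, ← cast_dQ]
  push_cast
  simp only [cast_dyadToRat]

/-- `esArr` casts to the section-node remainder `secErr` of glue XXX. [folklore] -/
theorem cast_esArr (n : ℕ) (qz : Array ℤ) (sr : SecRec) (E : Array Dyad) (Δ : ℚ) (c : Fin n) :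
    (((esArr n qz sr E Δ).getD c 0 : ℚ) : ℝ) =
      secErr (qvec (n := n) qz) (dvec (n := n) sr.p) (dvec (n := n) sr.κ) (dvec (n := n) E) (dvec (n := n) sr.Φ) (Δ : ℝ)
        (secQmax (qvec (n := n) qz) (dvec (n := n) sr.W)) c := by
  unfold esArr; rw [getD_ofFn, cast_secErrQ]

/-! ### The pieces of the READOUT-L test (top-level, so that the unfolded Boolean stays small) -/

/-- The weight at a flat window index `d ↔ (i, k)`: `ω_{i,k}` (same convention as `pxcoord`). [folklore] -/
def omegaFlat (Kb Ka : ℤ) (ωq : Fin m → ℤ → ℚ) (d : Fin (m * winLen Kb Ka)) : ℚ :=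
  ωq (finProdFinEquiv.symm d).1 (shellAt Kb (finProdFinEquiv.symm d).2)

/-- The amplitude covector in weighted coordinates: `Λ_d := ell_d · ω_d`. [folklore] -/
def lamArr (Kb Ka : ℤ) (ωq : Fin m → ℤ → ℚ) (ell : Array Dyad) : Array ℚ :=
  Array.ofFn fun d : Fin (m * winLen Kb Ka) => dyadToRat (dgetD ell d) * omegaFlat Kb Ka ωq d

/-- The Kronecker entry `[j = dp]`. [folklore] -/
def kronQ (j dp : ℕ) : ℚ := if j = dp then 1 else 0

/-- `Â := Σ_d Λ_d XS_d`. [folklore] -/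
def ahatQ (n : ℕ) (Lam XS : Array ℚ) : ℚ := ∑ d : Fin n, Lam.getD d 0 * XS.getD d 0

/-- `AC_col := Σ_d Λ_d CS_{d,col}` (the covector applied to the frame columns). [folklore] -/
def acArr (n : ℕ) (Lam : Array ℚ) (CS : Array (Array ℚ)) : Array ℚ :=
  Array.ofFn fun col : Fin n => ∑ d : Fin n, Lam.getD d 0 * qmgetD CS d col

/-- `δA := Σ_col |AC_col| r_col + Σ_d |Λ_d| ES_d` (the amplitude spread over the node). [folklore] -/
def dAQ (n : ℕ) (Lam AC : Array ℚ) (rD : Array Dyad) (ES : Array ℚ) : ℚ :=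
  (∑ col : Fin n, |AC.getD col 0| * dyadToRat (dgetD rD col)) + ∑ d : Fin n, |Lam.getD d 0| * ES.getD d 0

/-- `RS_d := Σ_col |CS_{d,col}| r_col + ES_d` (the node's box extent in coordinate `d`). [folklore] -/
def rsRowQ (n : ℕ) (CS : Array (Array ℚ)) (rD : Array Dyad) (ES : Array ℚ) (d : ℕ) : ℚ :=
  (∑ col : Fin n, |qmgetD CS d col| * dyadToRat (dgetD rD col)) + ES.getD d 0

/-- The matching numerator bound `N := Σ_col |Â CS_{d⁺,col} − XS_{d⁺} AC_col| r_col + Σ_j |Â [j = d⁺] − XS_{d⁺} Λ_j| ES_j`. [folklore] -/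
def nMatchQ (n : ℕ) (Lam AC : Array ℚ) (Ah : ℚ) (XS : Array ℚ) (CS : Array (Array ℚ)) (rD : Array Dyad) (ES : Array ℚ) (dp : ℕ) : ℚ :=
  (∑ col : Fin n, |Ah * qmgetD CS dp col - XS.getD dp 0 * AC.getD col 0| * dyadToRat (dgetD rD col)) +
    ∑ j : Fin n, |Ah * kronQ j dp - XS.getD dp 0 * Lam.getD j 0| * ES.getD j 0

/-- **The READOUT-L test** on a parallelepiped node `XS + CS ξ + e` (`|ξ_col| ≤ r_col`, `|e_d| ≤ ES_d`; weighted coordinates): with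
`Λ_d := ell_d ω_d`, `Â := Σ Λ_d XS_d`, `AC_col := Σ_d Λ_d CS_{d,col}`, `δA := Σ_col |AC_col| r_col + Σ_d |Λ_d| ES_d`, `A_lo/hi := Â ∓ δA`,
`a_lo/hi := A_lo/hi / Cs`, `RS_d := Σ_col |CS_{d,col}| r_col + ES_d`: (G) signs `0 < θd`, `0 < Cs`, `0 ≤ Zx`, `0 ≤ ρ r`, `0 ≤ 1+σ`; (F) floor
`0 < A_lo ∧ 1 ≤ a_lo^θd (1+q)^θn`; (S) slack `RS ≤ |XS| ∧ (1+σ) a_hi ≤ ω_{i₀,1}(|XS| − RS)` at `idx(i₀,1)`; (M) matching, for every window `k` with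
`k+1 ≤ Ka`, at `d⁺ = idx(i,k+1)` against the box entry `d = idx(i,k)`: `0 ≤ w_k`, `0 ≤ chw_d`, `spr := ω_{d⁺} N/(A_lo Â)`,
`w_k Cs (|ω_{d⁺} XS_{d⁺}/Â − cen_d| + spr − chw_d) ≤ ρ r`; (T) top `0 ≤ chw_{dT}`, `w_Ka (Et Cs/A_lo + Cs (|cen_{dT}| − chw_{dT})⁺) ≤ ρ r`,
`dT = idx(i,Ka)`; (X) exit `ω_{i,−Kb}(|XS| + RS) ≤ a_lo Zx` at `idx(i,−Kb)`. Same argument list and clauses as theory-1's `ReadoutLSpec.lean` v1.1.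
[folklore] -/
def checkReadoutL (m : ℕ) (Kb Ka : ℤ) (ωq : Fin m → ℤ → ℚ) (i₀ : Fin m) (q σ ρ r Zx Et : ℚ) (θn θd : ℕ) (wq : ℤ → ℚ)
    (Cs : ℚ) (ell cen chw : Array Dyad) (XS : Array ℚ) (CS : Array (Array ℚ)) (rD : Array Dyad) (ES : Array ℚ) : Bool :=
  let W := winLen Kb Ka
  let n := m * W
  let ix : Fin m → ℤ → ℕ := fun i k => (k + Kb).toNat + W * i.val
  let Lam : Array ℚ := lamArr Kb Ka ωq ell
  let Ah : ℚ := ahatQ n Lam XS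
  let AC : Array ℚ := acArr n Lam CS
  let dA : ℚ := dAQ n Lam AC rD ES
  let Alo : ℚ := Ah - dA
  let Ahi : ℚ := Ah + dA
  decide (0 < θd) && decide (0 < Cs) && decide (0 ≤ Zx) && decide (0 ≤ ρ * r) && decide (0 ≤ 1 + σ) && decide (0 < Alo) &&
  decide (1 ≤ (Alo / Cs) ^ θd * (1 + q) ^ θn) && decide (-Kb ≤ 1 ∧ 1 ≤ Ka) &&
  (decide (rsRowQ n CS rD ES (ix i₀ 1) ≤ |XS.getD (ix i₀ 1) 0|) &&
    decide ((1 + σ) * (Ahi / Cs) ≤ ωq i₀ 1 * (|XS.getD (ix i₀ 1) 0| - rsRowQ n CS rD ES (ix i₀ 1)))) &&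
  ((List.finRange m).all fun i => (List.range W).all fun cc =>
    let k : ℤ := (cc : ℤ) - Kb
    decide (0 ≤ wq k) && decide (0 ≤ dyadToRat (dgetD chw (ix i k))) &&
    (decide (Ka < k + 1) ||
      decide (wq k * Cs * (|ωq i (k + 1) * XS.getD (ix i (k + 1)) 0 / Ah - dyadToRat (dgetD cen (ix i k))| +
        ωq i (k + 1) * nMatchQ n Lam AC Ah XS CS rD ES (ix i (k + 1)) / (Alo * Ah) - dyadToRat (dgetD chw (ix i k))) ≤ ρ * r))) &&
  ((List.finRange m).all fun i =>
    decide (0 ≤ dyadToRat (dgetD chw (ix i Ka))) &&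
    decide (wq Ka * (Et * Cs / Alo + Cs * max (|dyadToRat (dgetD cen (ix i Ka))| - dyadToRat (dgetD chw (ix i Ka))) 0) ≤ ρ * r) &&
    decide (ωq i (-Kb) * (|XS.getD (ix i (-Kb)) 0| + rsRowQ n CS rD ES (ix i (-Kb))) ≤ (Alo / Cs) * Zx))

/-- **The fat core box** in STATE units: zero off the window, `|z_{i,k} − Cs·cen_d| ≤ Cs·chw_d` on it (`d = idx(i,k)`). [folklore] -/
def InCoreBox (Kb Ka : ℤ) (Cs : ℚ) (cen chw : Array Dyad) (z : Fin m → ℤ → ℝ) : Prop :=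
  (∀ i k, ¬(-Kb ≤ k ∧ k ≤ Ka) → z i k = 0) ∧
    ∀ (i : Fin m) (k : ℤ) (h : -Kb ≤ k ∧ k ≤ Ka),
      |z i k - (Cs : ℝ) * (dgetD cen (idxOf Kb Ka i k h)).toReal| ≤ (Cs : ℝ) * (dgetD chw (idxOf Kb Ka i k h)).toReal

/-! ### Clipping onto an interval -/

/-- `clip(t; [c − h, c + h])`. [folklore] -/
noncomputable def clipR (c h t : ℝ) : ℝ := max (c - h) (min (c + h) t)

/-- The clipped value lies in the interval (`0 ≤ h`). [folklore] -/
theorem abs_clipR_sub_le {c h : ℝ} (hh : 0 ≤ h) (t : ℝ) : |clipR c h t - c| ≤ h := by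
  unfold clipR
  rw [abs_le]
  constructor
  · have := le_max_left (c - h) (min (c + h) t); linarith
  · have h1 : min (c + h) t ≤ c + h := min_le_left _ _
    have h2 : max (c - h) (min (c + h) t) ≤ c + h := max_le (by linarith) h1
    linarith

/-- The clipping distance: `|t − clip t| ≤ (|t − c| − h)⁺`. [folklore] -/
theorem abs_sub_clipR_le (c h t : ℝ) (hh : 0 ≤ h) : |t - clipR c h t| ≤ max (|t - c| - h) 0 := by
  unfold clipR
  rcases le_total t (c + h) with h1 | h1
  · rw [min_eq_right h1]
    rcases le_total (c - h) t with h2 | h2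
    · rw [max_eq_right h2, sub_self, abs_zero]; exact le_max_right _ _
    · rw [max_eq_left h2]
      have e : |t - (c - h)| = (c - t) - h := by rw [abs_of_nonpos (by linarith)]; ring
      rw [e]
      refine le_trans ?_ (le_max_left _ _)
      have : c - t ≤ |t - c| := by rw [abs_sub_comm]; exact le_abs_self _
      linarith
  · rw [min_eq_left h1, max_eq_right (by linarith)]
    have e : |t - (c + h)| = (t - c) - h := by rw [abs_of_nonneg (by linarith)]; ring
    rw [e]
    refine le_trans ?_ (le_max_left _ _)
    linarith [le_abs_self (t - c)]

/-- The clip of `0`: `|clip 0| ≤ (|c| − h)⁺`. [folklore] -/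
theorem abs_clipR_zero_le {c h : ℝ} (hh : 0 ≤ h) : |clipR c h 0| ≤ max (|c| - h) 0 := by
  have h1 := abs_sub_clipR_le c h 0 hh
  rw [zero_sub, abs_neg, zero_sub, abs_neg] at h1
  exact h1

/-! ### Linear-algebra helpers -/

/-- Distributing the matching numerator over the node's generators. [folklore] -/
theorem match_numerator_identity {n : ℕ} (Ah X : ℝ) (CSrow AC ξ kr Λ e : Fin n → ℝ) :
    Ah * ((∑ col, CSrow col * ξ col) + ∑ j, kr j * e j) - X * ((∑ col, AC col * ξ col) + ∑ j, Λ j * e j) =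
      (∑ col, (Ah * CSrow col - X * AC col) * ξ col) + ∑ j, (Ah * kr j - X * Λ j) * e j := by
  have h1 : ∑ col, (Ah * CSrow col - X * AC col) * ξ col = Ah * ∑ col, CSrow col * ξ col - X * ∑ col, AC col * ξ col := by
    rw [Finset.mul_sum, Finset.mul_sum, ← Finset.sum_sub_distrib]
    exact Finset.sum_congr rfl fun _ _ => by ring
  have h2 : ∑ j, (Ah * kr j - X * Λ j) * e j = Ah * ∑ j, kr j * e j - X * ∑ j, Λ j * e j := by
    rw [Finset.mul_sum, Finset.mul_sum, ← Finset.sum_sub_distrib]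
    exact Finset.sum_congr rfl fun _ _ => by ring
  rw [h1, h2]; ring

/-- `|Σ a_col ξ_col + Σ b_j e_j| ≤ Σ |a_col| r_col + Σ |b_j| E_j` for `|ξ| ≤ r`, `|e| ≤ E`. [folklore] -/
theorem abs_pair_sum_le {n : ℕ} {a b ξ e r E : Fin n → ℝ} (hξ : ∀ c, |ξ c| ≤ r c) (he : ∀ c, |e c| ≤ E c) :
    |(∑ col, a col * ξ col) + ∑ j, b j * e j| ≤ (∑ col, |a col| * r col) + ∑ j, |b j| * E j := by
  refine (abs_add_le _ _).trans (add_le_add ?_ ?_)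
  · refine (Finset.abs_sum_le_sum_abs _ _).trans (Finset.sum_le_sum fun col _ => ?_)
    rw [abs_mul]; exact mul_le_mul_of_nonneg_left (hξ col) (abs_nonneg _)
  · refine (Finset.abs_sum_le_sum_abs _ _).trans (Finset.sum_le_sum fun j _ => ?_)
    rw [abs_mul]; exact mul_le_mul_of_nonneg_left (he j) (abs_nonneg _)

/-- A coordinate of the node displacement: `v_d = Σ_col CS_{d,col} ξ_col + Σ_j [j = d] e_j`. [folklore] -/
theorem mulVec_add_apply_kron {n : ℕ} (C : Matrix (Fin n) (Fin n) ℝ) (ξ e : Fin n → ℝ) (d : Fin n) :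
    (C.mulVec ξ + e) d = (∑ col, C d col * ξ col) + ∑ j : Fin n, (if (j : ℕ) = (d : ℕ) then (1 : ℝ) else 0) * e j := by
  simp only [Pi.add_apply, Matrix.mulVec, dotProduct]
  congr 1
  rw [Finset.sum_eq_single d]
  · simp
  · intro j _ hj
    have hne : (j : ℕ) ≠ (d : ℕ) := fun h => hj (Fin.ext h)
    rw [if_neg hne, zero_mul]
  · simp

/-- `kronQ` casts to the real Kronecker entry. [folklore] -/
theorem cast_kronQ (j dp : ℕ) : ((kronQ j dp : ℚ) : ℝ) = if j = dp then (1 : ℝ) else 0 := by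
  unfold kronQ; split_ifs <;> simp

end CertificateGlueOn

end Summit.NavierStokesRegularity.NavierStokesRegularity.Theorems
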